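import Mathlib
import Literature.RingTheory.KrullDimension.AffineDimension
import Summits.ResolutionOfSingularities.ResolutionOfSingularities.Theorems.WeightedInvariantGradedSimpleOrbitCharts
import Summits.ResolutionOfSingularities.ResolutionOfSingularities.Theorems.WeightedInvariantTorusChartDimension
import Summits.ResolutionOfSingularities.ResolutionOfSingularities.Theorems.WeightedInvariantLaurentKrullDimensionLe
import HarnessLib

/-!
# Orbit charts II: graded contraction along a chart map, and the exact dimension of a closed orbit

Route `ResolutionOfSingularities/WeightedInvariant`, door crux `HypersurfaceCentreConstruction`
(stmt-ResolutionOfSingularities-19897), e-ladder `e = 1` of `res-L1-w43-stub-10` (cell res-hironaka,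
`D/res-D-pv-025/E1Skeleton.lean`, stub `stub_e1_inv_succ` «torus bookkeeping L1»).  Two pieces of pure
graded algebra (nothing here is a claim about Hironaka's problem):

* §1 **Graded contraction** — the algebra of «new maximal singular points lie OVER OLD MAXIMAL POINTS»:
  for a ring map `φ : A → B` carrying the pieces of a grading `𝒜` (index `ι`) into the pieces of a grading
  `ℬ` (index `ι'`) along an INJECTIVE map of degrees `g : ι → ι'` (the structure map of a chart of the
  cobordant blow-up over an old torus chart: old degree `χ` becomes `(χ, 0)`), the contraction of a
  homogeneous ideal is homogeneous (`isHomogeneous_comap_of_graded`); hence if `P ≤ A` has GRADED-SIMPLE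
  quotient (a closed orbit) and `Q < B` is a proper homogeneous ideal over `P`, then `φ⁻¹ Q = P`
  (`comap_eq_of_gradedSimple`, with res-type-047's `eq_or_eq_top_of_isHomogeneous_of_gradedSimple`):
  a torus-stable point over a closed orbit lies over its generic point.
* §2 **Exact dimension of orbits** (complement to `Theorems/WeightedInvariantTorusChartDimension.lean`):
  `TorusChartDim.ringKrullDim_quotient_le` — `dim (A ⧸ P) ≤ dim (A₀ ⧸ P₀) + m` whenever `A₀ ⧸ P₀` is
  Noetherian (`A ⧸ P` is integral over the image of `(A₀ ⧸ P₀)[ℤᵐ]`; `ringKrullDim_le_of_isIntegral`,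
  `ringKrullDim_laurent_le`); `TorusChartDim.isField_gradeZero_quotient_of_gradedSimple` — over a graded-simple
  `P` the degree-`0` classes form a field; `TorusChartDim.ringKrullDim_quotient_eq_of_gradedSimple` —
  **a closed orbit with finite stabilisers has dimension exactly `m`**.

AI-written; weaker than expert review.  No statement of H. Hironaka's manuscript is used.
-/

noncomputable section

set_option linter.dupNamespace false -- mandated namespace of this single-conjunct summit

namespace Summit.ResolutionOfSingularities.ResolutionOfSingularities.Theorems

/-! ## §1 Graded contraction -/

section Contraction

variable {ι ι' A B σA σB : Type*} [CommRing A] [CommRing B] [DecidableEq ι] [DecidableEq ι']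
  [AddMonoid ι] [AddMonoid ι'] [SetLike σA A] [AddSubmonoidClass σA A] [SetLike σB B]
  [AddSubmonoidClass σB B] (𝒜 : ι → σA) (ℬ : ι' → σB) [GradedRing 𝒜] [GradedRing ℬ]

/-- **A graded ring map reads components**: if `φ` maps `𝒜 i` into `ℬ (g i)` with `g` injective, then
the `g i`-component of `φ x` is `φ` of the `i`-component of `x`. [folklore] -/
theorem proj_map_eq_map_proj (φ : A →+* B) (g : ι → ι') (hg : Function.Injective g)
    (hφ : ∀ i, ∀ a ∈ 𝒜 i, φ a ∈ ℬ (g i)) (x : A) (i : ι) :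
    GradedRing.proj ℬ (g i) (φ x) = φ (GradedRing.proj 𝒜 i x) := by
  classical
  conv_lhs => rw [← DirectSum.sum_support_decompose 𝒜 x, map_sum, map_sum]
  rw [Finset.sum_eq_single i]
  · rw [GradedRing.proj_apply, GradedRing.proj_apply,
      DirectSum.decompose_of_mem_same ℬ (hφ i _ (SetLike.coe_mem _))]
  · intro i' _ hne
    rw [GradedRing.proj_apply, DirectSum.decompose_of_mem_ne ℬ (hφ i' _ (SetLike.coe_mem _))]
    exact fun h => hne (hg h)
  · intro hi
    have h0 : (DirectSum.decompose 𝒜 x i : A) = 0 := by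
      rw [DFinsupp.notMem_support_iff.mp hi]; rfl
    show GradedRing.proj ℬ (g i) (φ (GradedRing.proj 𝒜 i x)) = 0
    rw [GradedRing.proj_apply 𝒜, h0, map_zero, map_zero]

/-- **The contraction of a homogeneous ideal along a graded map with injective degree map is
homogeneous.** [folklore] -/
theorem isHomogeneous_comap_of_graded (φ : A →+* B) (g : ι → ι') (hg : Function.Injective g)
    (hφ : ∀ i, ∀ a ∈ 𝒜 i, φ a ∈ ℬ (g i)) {Q : Ideal B} (hQ : Q.IsHomogeneous ℬ) :
    (Q.comap φ).IsHomogeneous 𝒜 := by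
  intro i x hx
  rw [Ideal.mem_comap] at hx ⊢
  have h := hQ (g i) hx
  rw [← GradedRing.proj_apply, proj_map_eq_map_proj 𝒜 ℬ φ g hg hφ x i, GradedRing.proj_apply] at h
  exact h

/-- **Graded-simple descent: a torus-stable point over a closed orbit lies over its generic point.**
If `A ⧸ P` is graded-simple (every homogeneous element outside `P` is a unit modulo `P` — the chart of a
CLOSED orbit with finite stabilisers), `φ : A → B` is graded along an injective degree map, and `Q` is a
PROPER homogeneous ideal of `B` with `P ≤ φ⁻¹ Q`, then `φ⁻¹ Q = P`. [folklore] -/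
theorem comap_eq_of_gradedSimple (φ : A →+* B) (g : ι → ι') (hg : Function.Injective g)
    (hφ : ∀ i, ∀ a ∈ 𝒜 i, φ a ∈ ℬ (g i)) {P : Ideal A}
    (hP : ∀ (i : ι) ⦃a : A⦄, a ∈ 𝒜 i → a ∉ P → IsUnit (Ideal.Quotient.mk P a))
    {Q : Ideal B} (hQ : Q.IsHomogeneous ℬ) (hQ1 : Q ≠ ⊤) (hPQ : P ≤ Q.comap φ) :
    Q.comap φ = P := by
  rcases eq_or_eq_top_of_isHomogeneous_of_gradedSimple 𝒜 hP
      (isHomogeneous_comap_of_graded 𝒜 ℬ φ g hg hφ hQ) hPQ with h | h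
  · exact h
  · exact absurd (Ideal.comap_eq_top_iff.mp h) hQ1

end Contraction

/-! ## §2 The exact dimension of a closed orbit -/

namespace TorusChartDim

variable {m : ℕ} {A : Type*} [CommRing A] (𝒜 : (Fin m → ℤ) → AddSubgroup A) [GradedRing 𝒜]

/-- **Upper bound for the dimension of an orbit closure**: with homogeneous units modulo the homogeneous
ideal `P` in the degrees `e • δᵢ`, `dim (A ⧸ P) ≤ dim (A₀ ⧸ P₀) + m` as soon as `A₀ ⧸ P₀` is Noetherian:
`A ⧸ P` is integral over the image of the Laurent ring `(A₀ ⧸ P₀)[ℤᵐ]` (`xᵉ` of a homogeneous `x` is a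
degree-`0` class times a unit monomial), integral extensions do not raise dimension
(`Literature.RingTheory.KrullDimension.ringKrullDim_le_of_isIntegral`), quotients neither, and
`dim R[ℤᵐ] ≤ dim R + m` (`ringKrullDim_laurent_le`). [folklore] -/
theorem ringKrullDim_quotient_le (P : Ideal A) (hP : P.IsHomogeneous 𝒜) {e : ℕ} (he : e ≠ 0)
    (hu : ∀ i : Fin m, ∃ w ∈ 𝒜 (e • (Pi.single i 1 : Fin m → ℤ)), IsUnit (Ideal.Quotient.mk P w))
    (hN : IsNoetherianRing (↥(SetLike.GradeZero.subring 𝒜) ⧸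
      P.comap (SetLike.GradeZero.subring 𝒜).subtype)) :
    ringKrullDim (A ⧸ P) ≤ ringKrullDim (↥(SetLike.GradeZero.subring 𝒜) ⧸
      P.comap (SetLike.GradeZero.subring 𝒜).subtype) + m := by
  classical
  -- notation (as in `ringKrullDim_gradeZero_quotient_add_le`)
  set A₀ : Subring A := SetLike.GradeZero.subring 𝒜 with hA₀
  have memA₀ : ∀ {x : A}, x ∈ A₀ ↔ x ∈ 𝒜 0 := fun {x} => Iff.rfl
  set P₀ : Ideal A₀ := P.comap A₀.subtype with hP₀
  let R := A₀ ⧸ P₀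
  let B := A ⧸ P
  let mk : A →+* B := Ideal.Quotient.mk P
  let f : R →+* B := Ideal.quotientMap P A₀.subtype le_rfl
  -- the units and their powers
  choose w hw hwu using hu
  let U : Fin m → Bˣ := fun i => (hwu i).unit
  let G : Multiplicative (Fin m → ℤ) →* B :=
    { toFun := fun χ => ∏ i, ((U i ^ (Multiplicative.toAdd χ i) : Bˣ) : B)
      map_one' := by simp
      map_mul' := fun χ χ' => by
        simp only [toAdd_mul, Pi.add_apply, zpow_add, Units.val_mul, Finset.prod_mul_distrib] }
  have hGunit : ∀ χ, IsUnit (G χ) := fun χ => by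
    have hG : G χ = ((∏ i, U i ^ (Multiplicative.toAdd χ i) : Bˣ) : B) := by
      simp only [G, MonoidHom.coe_mk, OneHom.coe_mk, Units.coe_prod]
    rw [hG]
    exact Units.isUnit _
  -- homogeneous representatives of the monomials
  have hGhom : ∀ χ : Fin m → ℤ, ∃ v ∈ 𝒜 (e • χ), mk v = G (Multiplicative.ofAdd χ) := by
    intro χ
    have hcoord : ∀ i, ∃ v ∈ 𝒜 (χ i • e • (Pi.single i 1 : Fin m → ℤ)),
        mk v = ((U i ^ (χ i) : Bˣ) : B) := fun i =>
      exists_homogeneous_zpow 𝒜 hP (hw i) (hwu i) (χ i)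
    choose v hv hvU using hcoord
    refine ⟨∏ i, v i, ?_, ?_⟩
    · have hmem := prod_mem_graded (𝒜 := 𝒜) Finset.univ (fun i => χ i • e • (Pi.single i 1 : Fin m → ℤ))
        v (fun i _ => hv i)
      have hdeg : ∑ i, χ i • e • (Pi.single i 1 : Fin m → ℤ) = e • χ := by
        ext j
        simp only [Finset.sum_apply, Pi.smul_apply, smul_eq_mul, Pi.single_apply]
        rw [Finset.sum_eq_single j]
        · simp; ring
        · intro i _ hij; simp [Ne.symm hij]
        · intro h; exact absurd (Finset.mem_univ j) h
      rwa [hdeg] at hmem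
    · simp only [map_prod, hvU, G, MonoidHom.coe_mk, OneHom.coe_mk, toAdd_ofAdd]
  choose v hv hvG using hGhom
  -- the Laurent ring and the evaluation map `ψ`
  let L := AddMonoidAlgebra R (Fin m → ℤ)
  let ψ : L →+* B := AddMonoidAlgebra.liftNCRingHom f G (fun _ _ => Commute.all _ _)
  have hψsingle : ∀ (χ : Fin m → ℤ) (c : A₀),
      ψ (AddMonoidAlgebra.single χ (Ideal.Quotient.mk P₀ c)) = mk ((c : A) * v χ) := by
    intro χ c
    show AddMonoidAlgebra.liftNCRingHom f G _ (AddMonoidAlgebra.single χ _) = _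
    rw [AddMonoidAlgebra.liftNCRingHom_single, map_mul, hvG]
    congr 1
  -- `B` is integral over `L` along `ψ`
  letI : Algebra L B := ψ.toAlgebra
  haveI hint : Algebra.IsIntegral L B := by
    refine ⟨fun b => ?_⟩
    obtain ⟨a, rfl⟩ := Ideal.Quotient.mk_surjective b
    rw [← DirectSum.sum_support_decompose 𝒜 a, map_sum]
    refine IsIntegral.sum _ fun χ _ => ?_
    set x : A := (DirectSum.decompose 𝒜 a χ : A) with hx
    have hxmem : x ∈ 𝒜 χ := SetLike.coe_mem _
    refine IsIntegral.of_pow (Nat.pos_of_ne_zero he) ?_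
    have hvunit : IsUnit (mk (v χ)) := by rw [hvG]; exact hGunit _
    obtain ⟨y, hy, hvy⟩ := exists_homogeneous_inverse 𝒜 hP (hv χ) hvunit
    have hc0 : x ^ e * y ∈ 𝒜 0 := by
      have := SetLike.mul_mem_graded (SetLike.pow_mem_graded e hxmem) hy
      rwa [add_neg_cancel] at this
    have hxe : (Ideal.Quotient.mk P x) ^ e =
        ψ (AddMonoidAlgebra.single χ (Ideal.Quotient.mk P₀ ⟨x ^ e * y, (memA₀).mpr hc0⟩)) := by
      rw [hψsingle, ← map_pow]
      change mk (x ^ e) = mk (x ^ e * y * v χ)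
      rw [Ideal.Quotient.eq]
      have : x ^ e - x ^ e * y * v χ = -(x ^ e * (v χ * y - 1)) := by ring
      rw [this]
      exact P.neg_mem (P.mul_mem_left _ hvy)
    rw [hxe]
    exact isIntegral_algebraMap
  -- `B` is integral over the image `L ⧸ ker ψ`, which embeds
  haveI : IsNoetherianRing R := hN
  calc ringKrullDim B ≤ ringKrullDim L :=
        Literature.RingTheory.KrullDimension.ringKrullDim_le_of_isIntegral (R := L) (S := B)
    _ ≤ ringKrullDim R + m := ringKrullDim_laurent_le R m

/-- **Over a graded-simple homogeneous ideal the degree-`0` classes form a field**: a degree-`0` element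
outside `P` is a unit modulo `P` with a degree-`0` inverse (`exists_homogeneous_inverse`). [folklore] -/
theorem isField_gradeZero_quotient_of_gradedSimple (P : Ideal A) [hPp : P.IsPrime]
    (hP : P.IsHomogeneous 𝒜)
    (hgs : ∀ (χ : Fin m → ℤ) ⦃a : A⦄, a ∈ 𝒜 χ → a ∉ P → IsUnit (Ideal.Quotient.mk P a)) :
    IsField (↥(SetLike.GradeZero.subring 𝒜) ⧸ P.comap (SetLike.GradeZero.subring 𝒜).subtype) := by
  set A₀ : Subring A := SetLike.GradeZero.subring 𝒜 with hA₀
  have memA₀ : ∀ {x : A}, x ∈ A₀ ↔ x ∈ 𝒜 0 := fun {x} => Iff.rfl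
  set P₀ : Ideal A₀ := P.comap A₀.subtype with hP₀
  haveI : P₀.IsPrime := Ideal.comap_isPrime _ _
  refine ⟨⟨0, 1, fun h => ?_⟩, mul_comm, fun {a} ha => ?_⟩
  · exact (Ideal.Quotient.isDomain P₀).toNontrivial.exists_pair_ne.elim
      fun x ⟨y, hxy⟩ => hxy (by rw [← mul_one x, ← mul_one y, ← h, mul_zero, mul_zero])
  · obtain ⟨a, rfl⟩ := Ideal.Quotient.mk_surjective a
    have haP : (a : A) ∉ P := fun h => ha (Ideal.Quotient.eq_zero_iff_mem.mpr h)
    have hunit := hgs 0 ((memA₀).mp a.2) haP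
    obtain ⟨y, hy, hay⟩ := exists_homogeneous_inverse 𝒜 hP ((memA₀).mp a.2) hunit
    rw [neg_zero] at hy
    refine ⟨Ideal.Quotient.mk P₀ ⟨y, (memA₀).mpr hy⟩, ?_⟩
    rw [← map_mul, ← map_one (Ideal.Quotient.mk P₀), Ideal.Quotient.eq]
    exact hay

/-- **A closed orbit with finite stabilisers has dimension exactly `m`.**  For a `ℤᵐ`-graded commutative
ring `A`, a homogeneous prime `P` with graded-simple quotient and homogeneous units modulo `P` in the degrees
`e • δᵢ` (`e ≠ 0`): `dim (A ⧸ P) = m` (lower bound `le_ringKrullDim_quotient`; upper bound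
`ringKrullDim_quotient_le` over the FIELD `A₀ ⧸ P₀`). [folklore] -/
theorem ringKrullDim_quotient_eq_of_gradedSimple (P : Ideal A) [hPp : P.IsPrime]
    (hP : P.IsHomogeneous 𝒜) {e : ℕ} (he : e ≠ 0)
    (hu : ∀ i : Fin m, ∃ w ∈ 𝒜 (e • (Pi.single i 1 : Fin m → ℤ)), IsUnit (Ideal.Quotient.mk P w))
    (hgs : ∀ (χ : Fin m → ℤ) ⦃a : A⦄, a ∈ 𝒜 χ → a ∉ P → IsUnit (Ideal.Quotient.mk P a)) :
    ringKrullDim (A ⧸ P) = m := by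
  have hF := isField_gradeZero_quotient_of_gradedSimple 𝒜 P hP hgs
  letI := hF.toField
  refine le_antisymm ?_ (le_ringKrullDim_quotient 𝒜 P hP hPp.ne_top he hu)
  have h := ringKrullDim_quotient_le 𝒜 P hP he hu inferInstance
  rwa [ringKrullDim_eq_zero_of_isField hF, zero_add] at h

end TorusChartDim

end Summit.ResolutionOfSingularities.ResolutionOfSingularities.Theorems

end
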